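import Summits.QuantumFields.YangMills.Theorems.BalabanUVNodesK0RecordFormatNamesFluctInt
import Summits.QuantumFields.YangMills.Theorems.BalabanUVNodesPortS1RecordDt

/-!
# K0⁷ — THE RECORD-SIDE FORMAT NAMES, EDITION 32 = FLUCTUATION CARRIERS, STAGE 2 CLOSED: `recordFluctInt` — print's (2.13) `𝐄^{(k+1)}(g_k, U_{k+1}(W_B))` AT THE RECORD
# (ed.31's `recordFluctIntDtOf` at ▶ PT-A-1's ✓`recordDt` (p828226); ★★★ director-ym №593∕№594 (5)∕№597; ▶ PT-A-1 `FE-SPLIT-PROPOSAL-v2.md` §1's consumer signature)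

Cell `ym-nodeO-ideate` ∕ `ym-balaban-port`, DEFINER seat `ym-nodeO-def-1` (gen 39); `--kind definition --supports stmt-QuantumFields-20541 --as helper`; count-neutral.
[I] = [Balaban1987RG1].

WHAT THIS FILE IS (two one-line definitions + `rfl` faces): ★★★ `recordFluctInt F Mc a₀ ε₂₉ ε₁ ρ k v n B := recordFluctIntDtOf F k (fun K Vk => recordDt F k K Vk ρ) Mc a₀ ε₂₉ ε₁ v n B` — the CLOSED
carrier: every socket of ed.27–31 pinned BY NAME ((o1) `D̃ := recordDt … ρ` — ▶ PT-A-1's unique-fixed-point selector, radius `ρ` EXPLICIT (the letters pin `ρ := ρ₀(d,L,α)` of ✓`recordDt_spec_uniform`);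
(o2) `fluctSigma`; (o3) `recordDtJacOf`; (o4) `recordEkBracket`; the Gaussian ✓`recordFluctMeasure`; χ = `chiFluctPrinted ε₁`); `recordFluctData F Mc a₀ ε₂₉ ε₁ ρ k v n` the pinned `FluctData`.
Signature = ▶ PT-A-1's §1 `recordFluctInt F Mc a₀ ε₂₉ k v n` with the two radii `ε₁` ((2.9), scaled variable) and `ρ` (D̃'s ball) displayed — FE-1∕FE-2 quantify or pin them.
◆ CRIT-1 g39's NON-BLOCKING F1 NOTE (nodeO STATUS l.5865, for hand-FE∕(T2)): print normalises (2.12) by «𝐍_k = the integral above at U_{k+1} = 1» (p.268 l.12), whereas ed.31 subtracts the chart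
exponent at the chart origin `B′ = 0` for the GIVEN `U_{k+1}(W_B)`; whether `FluctData.newTerm` carries the `−log 𝐍_k(U_{k+1} = 1)` is a CONSTANTS question inside `𝐏` ((c4): «(T2) fixes constants»)
— FE-1's (T2) cut checks `𝐄^{(k+1)}(g_k, 1) = 0` ((2.14)); nothing of it is asserted here.

HONEST FRAMING.  Definitions only; NOTHING of Bałaban's (2.10)–(2.14) is asserted, ported or discharged (not the chart law, not the exponent algebra, not (2.14), not analyticity∕localisation);
junk as SAID in ed.27–31 and in ✓`recordDt` (`0` off the ball); `stub_FE` (XXL) ∕ `stub_P0C` OPEN, ⟨27930⟩ OPEN (1∕3); K0⁷ ∕ K0ᴬ ∕ K1ᴬ ∕ K3ᴬ OPEN; NODE O 0∕1; COUNT 8∕28 · K 1∕4 UNMOVED; finite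
`𝕋⁴_{L^K}` at fixed ε — NOT continuum ∕ ℝ⁴ ∕ OS; **the Yang–Mills mass gap (Clay) is NOT proved by any of this.**  No `sorry`, `instance`, `notation`; standard axioms.
-/

noncomputable section

namespace Summit.QuantumFields.YangMills.Theorems.K0RecordFormatNames

open Literature.MathematicalPhysics.QuantumFieldTheory.Balaban1983to89
open Literature.MathematicalPhysics.QuantumFieldTheory.Balaban1983to89.Node00
open Literature.MathematicalPhysics.QuantumFieldTheory.Balaban1983to89.T4Continuum (T4Family)
open Summit.QuantumFields.YangMills.Theorems.BalabanUVNodesPortS1 (recordDt)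

variable (F : T4Family)

/-! ## §24r  The closed carrier -/

/-- ★★ **THE RECORD `FluctData`, ALL SOCKETS PINNED**: `recordFluctData F Mc a₀ ε₂₉ ε₁ ρ k v n := recordFluctDataDtOf F k (recordDt F k (recordK₀ F Mc k + n) · ρ) a₀ ε₂₉ ε₁ v` at volume
`recordK₀ F Mc k + n`. [cite: Balaban1987RG1, (2.12)–(2.13) p.268] -/
def recordFluctData (Mc : ℕ) (a₀ ε₂₉ ε₁ ρ : ℝ) (k : ℕ) (v : Fin (k + 1) → ℝ) (n : ℕ) :
    B12Eq213Body268.FluctData (recordW F a₀ ε₂₉ k (recordK₀ F Mc k + n)) :=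
  recordFluctDataDtOf F k (fun Vk => recordDt F k (recordK₀ F Mc k + n) Vk ρ) a₀ ε₂₉ ε₁ v

/-- ★★★ **`recordFluctInt` — PRINT's (2.13) `𝐄^{(k+1)}(g_k, U_{k+1}(W_B))` AT THE RECORD, CLOSED**: `= recordFluctIntDtOf F k (fun K Vk => recordDt F k K Vk ρ) Mc a₀ ε₂₉ ε₁ v n B`
= `log ∫ dμ_{C^{(k)}}(B′) χ_k exp[𝐏^{(k)}(g_k, U_{k+1}, B′) + {…}]` with `g_k = v (Fin.last k)`, at volume `recordK₀ F Mc k + n`. The object FE-1 (`FESplitGermBox`) and FE-2 (`FEClusterHalfBox`) speak about.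
[cite: Balaban1987RG1, (2.13) p.268] -/
def recordFluctInt (Mc : ℕ) (a₀ ε₂₉ ε₁ ρ : ℝ) (k : ℕ) (v : Fin (k + 1) → ℝ) (n : ℕ) (B : recordW F a₀ ε₂₉ k (recordK₀ F Mc k + n)) : ℝ :=
  recordFluctIntDtOf F k (fun K Vk => recordDt F k K Vk ρ) Mc a₀ ε₂₉ ε₁ v n B

/-- FACE (`rfl`): the closed carrier is the pinned datum's new term at `g_k = v (Fin.last k)`. [cite: Balaban1987RG1, (2.13) p.268 (bookkeeping)] -/
theorem recordFluctInt_eq_newTerm (Mc : ℕ) (a₀ ε₂₉ ε₁ ρ : ℝ) (k : ℕ) (v : Fin (k + 1) → ℝ) (n : ℕ) (B : recordW F a₀ ε₂₉ k (recordK₀ F Mc k + n)) :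
    recordFluctInt F Mc a₀ ε₂₉ ε₁ ρ k v n B = (recordFluctData F Mc a₀ ε₂₉ ε₁ ρ k v n).newTerm (v (Fin.last k)) B := rfl

/-- FACE (`rfl`): unfolding to the socket edition. [cite: Balaban1987RG1, (2.13) p.268 (bookkeeping)] -/
theorem recordFluctInt_eq (Mc : ℕ) (a₀ ε₂₉ ε₁ ρ : ℝ) (k : ℕ) (v : Fin (k + 1) → ℝ) (n : ℕ) (B : recordW F a₀ ε₂₉ k (recordK₀ F Mc k + n)) :
    recordFluctInt F Mc a₀ ε₂₉ ε₁ ρ k v n B = recordFluctIntDtOf F k (fun K Vk => recordDt F k K Vk ρ) Mc a₀ ε₂₉ ε₁ v n B := rfl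

end Summit.QuantumFields.YangMills.Theorems.K0RecordFormatNames

end
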